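import Mathlib
import Summits.NavierStokesRegularity.NavierStokesRegularity.Theorems.EulerZoomLiouvillePowerGaugeEulerLiouvilleNeedleDiscChart
import Literature.Analysis.FluidPDE.CylindricalIntegration
import HarnessLib

/-!
# Needle thin-core portrait of the crux `EulerZoomLiouville.PowerGaugeEulerLiouville` — tools:
# Tonelli over a solid cylinder through the transversal disc charts, and Chebyshev slice selection

Route №10 `EulerZoomLiouville` (NavierStokesRegularity), crux E = stmt-NavierStokesRegularity-19832,
registered open stub `stub_selfSimilarC2Needle` (THE ONE STATEMENT); LEAD ns-typeII-p2 g10's needle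
log-capacity portrait (RESIDUE-MEMO-19832-g10 §5.2), member end (P2c/P2d, this seat), built on
nsreg-p2 g31's plates `…NeedleLogCapacity(Disc)` / `…NeedleDiscChart` and ns-sfl-p1's per-disc step.
This file is measure-theoretic plumbing only:

* `NeedleThinCore.cylFrame` — the linear isometry of `ℝ³` sending the standard frame to an orthonormal
  frame `(e₁, e₂, n)`; `NeedleThinCore.cylChart y₀ e₁ e₂ n : ℝ × ℝ² ≃ᵐ ℝ³`,
  `(t, w) ↦ y₀ + w₀ e₁ + w₁ e₂ + t n`, is MEASURE PRESERVING (`cylSplit` of the tree, the frame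
  isometry, a translation) and its `w`-slices are the disc charts `discChart (y₀ + t • n) e₁ e₂` of
  `…NeedleDiscChart` read through `ℂ ≃ᵐ ℝ²`;
* `NeedleThinCore.lintegral_slices_le_ball` — **Tonelli over the cylinder**: for measurable
  `F : ℝ³ → ℝ≥0∞`, `∫_{t ∈ [0,h]} ∫_{‖z‖<δ} F(discChart (y₀ + t n) e₁ e₂ z) dz dt ≤ ∫_{B(0,R)} F`
  as soon as every charted point lies in `B(0, R)`;
* `NeedleThinCore.exists_slice_le_of_lintegral_le` — **Chebyshev slice selection**: two measurable
  slice functionals `X, Y : ℝ → ℝ≥0∞` with `∫_{[0,h]} X ≤ A`, `∫_{[0,h]} Y ≤ B` (`h > 0`, `A, B < ∞`)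
  admit a common slice `t ∈ [0, h]` with `X t ≤ 4A/h` and `Y t ≤ 4B/h`.

WHAT THIS IS NOT: not NS, not E, not the stub — tools for a kernel portrait; `--supports` stmt-19832.
[folklore]
-/

noncomputable section

-- flat `Theorems/<Route><Decl>…` files of one crux share the namespace of the crux (tree convention)
set_option linter.dupNamespace false

open MeasureTheory Set Filter Topology Metric Function
open scoped ENNReal NNReal RealInnerProductSpace

namespace Summit.NavierStokesRegularity.NavierStokesRegularity.Theorems.PowerGaugeEulerLiouville

open Literature.Analysis Literature.Analysis.FluidPDE NeedleDiscChart

namespace NeedleThinCore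

/-! ## The orthonormal frame and the cylinder chart -/

section Chart

variable {e₁ e₂ n : EuclideanSpace ℝ (Fin 3)}

/-- The frame `(e₁, e₂, n)` as a map `Fin 3 → ℝ³`. -/
def frameVec (e₁ e₂ n : EuclideanSpace ℝ (Fin 3)) : Fin 3 → EuclideanSpace ℝ (Fin 3) := ![e₁, e₂, n]

/-- An orthonormal triple in `ℝ³` is an orthonormal family. [folklore] -/
theorem orthonormal_frameVec (h₁ : ‖e₁‖ = 1) (h₂ : ‖e₂‖ = 1) (hn : ‖n‖ = 1)
    (h12 : ⟪e₁, e₂⟫ = 0) (h1n : ⟪e₁, n⟫ = 0) (h2n : ⟪e₂, n⟫ = 0) :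
    Orthonormal ℝ (frameVec e₁ e₂ n) := by
  rw [orthonormal_iff_ite]
  intro i j
  fin_cases i <;> fin_cases j <;>
    simp [frameVec, h₁, h₂, hn, h12, h1n, h2n, real_inner_comm]

/-- The orthonormal basis of `ℝ³` given by an orthonormal triple. [folklore] -/
def frameBasis (h₁ : ‖e₁‖ = 1) (h₂ : ‖e₂‖ = 1) (hn : ‖n‖ = 1)
    (h12 : ⟪e₁, e₂⟫ = 0) (h1n : ⟪e₁, n⟫ = 0) (h2n : ⟪e₂, n⟫ = 0) :
    OrthonormalBasis (Fin 3) ℝ (EuclideanSpace ℝ (Fin 3)) :=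
  OrthonormalBasis.mk (orthonormal_frameVec h₁ h₂ hn h12 h1n h2n) (by
    have hcard : Fintype.card (Fin 3) = Module.finrank ℝ (EuclideanSpace ℝ (Fin 3)) := by
      rw [finrank_euclideanSpace_fin]; simp
    have hb := (basisOfOrthonormalOfCardEqFinrank (orthonormal_frameVec h₁ h₂ hn h12 h1n h2n) hcard).span_eq
    rw [coe_basisOfOrthonormalOfCardEqFinrank] at hb
    exact hb.ge)

/-- The frame isometry maps coordinates `v` to `v₀ e₁ + v₁ e₂ + v₂ n`. [folklore] -/
theorem frameBasis_repr_symm_apply (h₁ : ‖e₁‖ = 1) (h₂ : ‖e₂‖ = 1) (hn : ‖n‖ = 1)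
    (h12 : ⟪e₁, e₂⟫ = 0) (h1n : ⟪e₁, n⟫ = 0) (h2n : ⟪e₂, n⟫ = 0) (v : EuclideanSpace ℝ (Fin 3)) :
    (frameBasis h₁ h₂ hn h12 h1n h2n).repr.symm v = v 0 • e₁ + v 1 • e₂ + v 2 • n := by
  rw [← OrthonormalBasis.sum_repr_symm, Fin.sum_univ_three]
  simp [frameBasis, OrthonormalBasis.coe_mk, frameVec]

/-- The cylinder chart `(t, w) ↦ y₀ + w₀ e₁ + w₁ e₂ + t n` as a measurable equivalence `ℝ × ℝ² ≃ᵐ ℝ³`. -/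
def cylChart (y₀ : EuclideanSpace ℝ (Fin 3)) (h₁ : ‖e₁‖ = 1) (h₂ : ‖e₂‖ = 1) (hn : ‖n‖ = 1)
    (h12 : ⟪e₁, e₂⟫ = 0) (h1n : ⟪e₁, n⟫ = 0) (h2n : ⟪e₂, n⟫ = 0) :
    ℝ × EuclideanSpace ℝ (Fin 2) ≃ᵐ EuclideanSpace ℝ (Fin 3) :=
  (cylSplit.symm.trans (frameBasis h₁ h₂ hn h12 h1n h2n).repr.symm.toHomeomorph.toMeasurableEquiv).trans
    (MeasurableEquiv.addLeft y₀)

/-- The cylinder chart in coordinates. [folklore] -/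
theorem cylChart_apply (y₀ : EuclideanSpace ℝ (Fin 3)) (h₁ : ‖e₁‖ = 1) (h₂ : ‖e₂‖ = 1) (hn : ‖n‖ = 1)
    (h12 : ⟪e₁, e₂⟫ = 0) (h1n : ⟪e₁, n⟫ = 0) (h2n : ⟪e₂, n⟫ = 0) (t : ℝ) (w : EuclideanSpace ℝ (Fin 2)) :
    cylChart y₀ h₁ h₂ hn h12 h1n h2n (t, w) = y₀ + (w 0 • e₁ + w 1 • e₂ + t • n) := by
  change y₀ + (frameBasis h₁ h₂ hn h12 h1n h2n).repr.symm (cylSplit.symm (t, w)) = _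
  rw [cylSplit_symm_apply, frameBasis_repr_symm_apply]
  simp

/-- The cylinder chart preserves Lebesgue measure. [folklore] -/
theorem measurePreserving_cylChart (y₀ : EuclideanSpace ℝ (Fin 3)) (h₁ : ‖e₁‖ = 1) (h₂ : ‖e₂‖ = 1)
    (hn : ‖n‖ = 1) (h12 : ⟪e₁, e₂⟫ = 0) (h1n : ⟪e₁, n⟫ = 0) (h2n : ⟪e₂, n⟫ = 0) :
    MeasurePreserving (cylChart y₀ h₁ h₂ hn h12 h1n h2n) volume volume := by
  refine MeasurePreserving.trans ?_ (measurePreserving_add_left volume y₀)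
  exact measurePreserving_cylSplit_symm.trans (frameBasis h₁ h₂ hn h12 h1n h2n).measurePreserving_repr_symm

/-- The measurable equivalence `ℂ ≃ᵐ ℝ²`, `z ↦ (re z, im z)`. -/
def complexToR2 : ℂ ≃ᵐ EuclideanSpace ℝ (Fin 2) :=
  Complex.measurableEquivPi.trans (MeasurableEquiv.toLp 2 (Fin 2 → ℝ))

/-- Coordinates of `complexToR2`. [folklore] -/
theorem complexToR2_apply_zero (z : ℂ) : complexToR2 z 0 = z.re := by
  simp [complexToR2, MeasurableEquiv.trans_apply, Complex.measurableEquivPi_apply]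

/-- Coordinates of `complexToR2`. [folklore] -/
theorem complexToR2_apply_one (z : ℂ) : complexToR2 z 1 = z.im := by
  simp [complexToR2, MeasurableEquiv.trans_apply, Complex.measurableEquivPi_apply]

/-- `complexToR2` preserves Lebesgue measure. [folklore] -/
theorem measurePreserving_complexToR2 : MeasurePreserving complexToR2 volume volume :=
  Complex.volume_preserving_equiv_pi.trans
    ((EuclideanSpace.volume_preserving_symm_measurableEquiv_toLp (Fin 2)).symm _)

/-- `complexToR2` preserves the norm. [folklore] -/
theorem norm_complexToR2 (z : ℂ) : ‖complexToR2 z‖ = ‖z‖ := by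
  rw [EuclideanSpace.norm_eq, Fin.sum_univ_two, complexToR2_apply_zero, complexToR2_apply_one,
    Complex.norm_eq_sqrt_sq_add_sq]
  simp [Real.norm_eq_abs, sq_abs]

/-- The `w`-slices of the cylinder chart are the disc charts: `cylChart (t, complexToR2 z) =
discChart (y₀ + t • n) e₁ e₂ z`. [folklore] -/
theorem cylChart_complexToR2 (y₀ : EuclideanSpace ℝ (Fin 3)) (h₁ : ‖e₁‖ = 1) (h₂ : ‖e₂‖ = 1)
    (hn : ‖n‖ = 1) (h12 : ⟪e₁, e₂⟫ = 0) (h1n : ⟪e₁, n⟫ = 0) (h2n : ⟪e₂, n⟫ = 0) (t : ℝ) (z : ℂ) :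
    cylChart y₀ h₁ h₂ hn h12 h1n h2n (t, complexToR2 z) = discChart (y₀ + t • n) e₁ e₂ z := by
  rw [cylChart_apply, complexToR2_apply_zero, complexToR2_apply_one, discChart]
  abel

end Chart

/-! ## Tonelli over the cylinder -/

section Tonelli

variable {e₁ e₂ n : EuclideanSpace ℝ (Fin 3)}

/-- **Tonelli over a solid cylinder through its transversal disc charts.**  For a measurable
`F : ℝ³ → [0, ∞]`, an orthonormal frame `(e₁, e₂, n)`, a base point `y₀`, a height `h` and a radius
`δ`: if every charted point `discChart (y₀ + t • n) e₁ e₂ z` with `t ∈ [0, h]`, `‖z‖ < δ` lies in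
`B(0, R)`, then `∫_{t ∈ [0,h]} ∫_{‖z‖ < δ} F(discChart (y₀ + t • n) e₁ e₂ z) dz dt ≤ ∫_{B(0,R)} F`
(the cylinder chart is measure preserving and injective). [folklore] -/
theorem lintegral_slices_le_ball {F : EuclideanSpace ℝ (Fin 3) → ℝ≥0∞} (hF : Measurable F)
    (y₀ : EuclideanSpace ℝ (Fin 3)) (h₁ : ‖e₁‖ = 1) (h₂ : ‖e₂‖ = 1) (hn : ‖n‖ = 1)
    (h12 : ⟪e₁, e₂⟫ = 0) (h1n : ⟪e₁, n⟫ = 0) (h2n : ⟪e₂, n⟫ = 0) {h δ R : ℝ}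
    (hR : ∀ t ∈ Icc (0 : ℝ) h, ∀ z : ℂ, ‖z‖ < δ →
      discChart (y₀ + t • n) e₁ e₂ z ∈ ball (0 : EuclideanSpace ℝ (Fin 3)) R) :
    ∫⁻ t in Icc (0 : ℝ) h, ∫⁻ z in ball (0 : ℂ) δ, F (discChart (y₀ + t • n) e₁ e₂ z) ≤
      ∫⁻ y in ball (0 : EuclideanSpace ℝ (Fin 3)) R, F y := by
  set Ψ := cylChart y₀ h₁ h₂ hn h12 h1n h2n with hΨ
  have hΨm := measurePreserving_cylChart y₀ h₁ h₂ hn h12 h1n h2n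
  -- the integrand on `ℝ × ℝ²`
  set S : Set (ℝ × EuclideanSpace ℝ (Fin 2)) := Icc (0 : ℝ) h ×ˢ ball 0 δ with hS
  have hSm : MeasurableSet S := measurableSet_Icc.prod measurableSet_ball
  set K : ℝ × EuclideanSpace ℝ (Fin 2) → ℝ≥0∞ := S.indicator fun q => F (Ψ q) with hK
  have hFΨ : Measurable fun q : ℝ × EuclideanSpace ℝ (Fin 2) => F (Ψ q) := hF.comp Ψ.measurable
  have hKm : Measurable K := hFΨ.indicator hSm
  -- (1) rewrite the iterated integral as `∫⁻ K ∂(volume.prod volume)`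
  have hinner : ∀ t : ℝ, ∫⁻ z in ball (0 : ℂ) δ, F (discChart (y₀ + t • n) e₁ e₂ z) =
      ∫⁻ w, (ball (0 : EuclideanSpace ℝ (Fin 2)) δ).indicator (fun w => F (Ψ (t, w))) w := by
    intro t
    rw [← lintegral_indicator measurableSet_ball,
      ← measurePreserving_complexToR2.lintegral_comp_emb complexToR2.measurableEmbedding]
    refine lintegral_congr fun z => ?_
    have hmem : z ∈ ball (0 : ℂ) δ ↔ complexToR2 z ∈ ball (0 : EuclideanSpace ℝ (Fin 2)) δ := by
      rw [mem_ball_zero_iff, mem_ball_zero_iff, norm_complexToR2]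
    by_cases hz : z ∈ ball (0 : ℂ) δ
    · rw [indicator_of_mem hz, indicator_of_mem (hmem.1 hz), hΨ, cylChart_complexToR2]
    · rw [indicator_of_notMem hz, indicator_of_notMem (fun h => hz (hmem.2 h))]
  have hiter : ∫⁻ t in Icc (0 : ℝ) h, ∫⁻ z in ball (0 : ℂ) δ, F (discChart (y₀ + t • n) e₁ e₂ z) =
      ∫⁻ q, K q ∂((volume : Measure ℝ).prod (volume : Measure (EuclideanSpace ℝ (Fin 2)))) := by
    rw [lintegral_prod _ hKm.aemeasurable, ← lintegral_indicator measurableSet_Icc]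
    refine lintegral_congr fun t => ?_
    by_cases ht : t ∈ Icc (0 : ℝ) h
    · rw [indicator_of_mem ht, hinner t]
      refine lintegral_congr fun w => ?_
      by_cases hw : w ∈ ball (0 : EuclideanSpace ℝ (Fin 2)) δ
      · rw [indicator_of_mem hw, hK, indicator_of_mem (mk_mem_prod ht hw)]
      · rw [indicator_of_notMem hw, hK, indicator_of_notMem (fun hq => hw hq.2)]
    · rw [indicator_of_notMem ht]
      have hzero : ∀ w : EuclideanSpace ℝ (Fin 2), K (t, w) = 0 := fun w => by
        rw [hK, indicator_of_notMem (fun hq => ht hq.1)]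
      simp only [hzero, lintegral_zero]
  -- (2) change variables through the measure-preserving chart
  have hchange : ∫⁻ q, K q ∂((volume : Measure ℝ).prod (volume : Measure (EuclideanSpace ℝ (Fin 2)))) =
      ∫⁻ y, K (Ψ.symm y) := by
    rw [← Measure.volume_eq_prod]
    exact ((hΨm.symm Ψ).lintegral_comp_emb Ψ.symm.measurableEmbedding K).symm
  -- (3) pointwise comparison with `1_{B(0,R)} F`
  have hpt : ∀ y, K (Ψ.symm y) ≤ (ball (0 : EuclideanSpace ℝ (Fin 3)) R).indicator F y := by
    intro y
    by_cases hq : Ψ.symm y ∈ S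
    · have hy : y ∈ ball (0 : EuclideanSpace ℝ (Fin 3)) R := by
        have ht : (Ψ.symm y).1 ∈ Icc (0 : ℝ) h := hq.1
        have hw : ‖(Ψ.symm y).2‖ < δ := mem_ball_zero_iff.1 hq.2
        set z : ℂ := complexToR2.symm (Ψ.symm y).2 with hz
        have hzw : complexToR2 z = (Ψ.symm y).2 := by rw [hz, MeasurableEquiv.apply_symm_apply]
        have hzn : ‖z‖ < δ := by rw [← norm_complexToR2, hzw]; exact hw
        have h := hR _ ht z hzn
        rwa [← cylChart_complexToR2 y₀ h₁ h₂ hn h12 h1n h2n, hzw, ← hΨ, Prod.mk.eta,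
          MeasurableEquiv.apply_symm_apply] at h
      rw [hK, indicator_of_mem hq, indicator_of_mem hy, MeasurableEquiv.apply_symm_apply]
    · rw [hK, indicator_of_notMem hq]
      exact bot_le
  rw [hiter, hchange, ← lintegral_indicator measurableSet_ball]
  exact lintegral_mono hpt

end Tonelli

/-! ## Chebyshev slice selection -/

section Chebyshev

/-- **Two slice functionals have a common good slice** (Markov twice): if `X, Y : ℝ → [0,∞]` are
measurable with `∫_{[0,h]} X ≤ A`, `∫_{[0,h]} Y ≤ B` (`h > 0`, `0 < A, B < ∞`), then some `t ∈ [0, h]`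
has `h · X t ≤ 4A` and `h · Y t ≤ 4B` (each exceptional set has measure `≤ h/4`). [folklore] -/
theorem exists_slice_le_of_lintegral_le {X Y : ℝ → ℝ≥0∞} (hX : Measurable X) (hY : Measurable Y)
    {h : ℝ} (hh : 0 < h) {A B : ℝ≥0∞} (hA0 : A ≠ 0) (hA : A ≠ ⊤) (hB0 : B ≠ 0) (hB : B ≠ ⊤)
    (hXA : ∫⁻ t in Icc (0 : ℝ) h, X t ≤ A) (hYB : ∫⁻ t in Icc (0 : ℝ) h, Y t ≤ B) :
    ∃ t ∈ Icc (0 : ℝ) h, ENNReal.ofReal h * X t ≤ 4 * A ∧ ENNReal.ofReal h * Y t ≤ 4 * B := by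
  by_contra hcon
  have hcon' : ∀ t ∈ Icc (0 : ℝ) h, ENNReal.ofReal h * X t ≤ 4 * A → 4 * B < ENNReal.ofReal h * Y t :=
    fun t ht hXt => not_le.1 fun hYt => hcon ⟨t, ht, hXt, hYt⟩
  -- the exceptional sets
  set E₁ : Set ℝ := Icc (0 : ℝ) h ∩ {t | 4 * A < ENNReal.ofReal h * X t} with hE₁
  set E₂ : Set ℝ := Icc (0 : ℝ) h ∩ {t | 4 * B < ENNReal.ofReal h * Y t} with hE₂
  have hE₁m : MeasurableSet E₁ :=
    measurableSet_Icc.inter (measurableSet_lt measurable_const (hX.const_mul _))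
  have hE₂m : MeasurableSet E₂ :=
    measurableSet_Icc.inter (measurableSet_lt measurable_const (hY.const_mul _))
  -- each has measure `≤ h/4`
  have hquarter : ∀ {Z : ℝ → ℝ≥0∞} (_ : Measurable Z) {C : ℝ≥0∞} (_ : C ≠ 0) (_ : C ≠ ⊤)
      (_ : ∫⁻ t in Icc (0 : ℝ) h, Z t ≤ C) {E : Set ℝ} (_ : MeasurableSet E) (_ : E ⊆ Icc (0 : ℝ) h)
      (_ : ∀ t ∈ E, 4 * C < ENNReal.ofReal h * Z t), volume E ≤ ENNReal.ofReal h / 4 := by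
    intro Z hZ C hC0 hC hZC E hEm hEI hElt
    -- `4C · vol E ≤ ∫_E h Z ≤ h ∫_{[0,h]} Z ≤ h C`
    have h1 : 4 * C * volume E ≤ ENNReal.ofReal h * C := by
      calc 4 * C * volume E = ∫⁻ t in E, 4 * C := by rw [setLIntegral_const, mul_comm]
        _ ≤ ∫⁻ t in E, ENNReal.ofReal h * Z t :=
            setLIntegral_mono (hZ.const_mul _) fun t ht => (hElt t ht).le
        _ ≤ ∫⁻ t in Icc (0 : ℝ) h, ENNReal.ofReal h * Z t := lintegral_mono_set hEI
        _ = ENNReal.ofReal h * ∫⁻ t in Icc (0 : ℝ) h, Z t := by rw [lintegral_const_mul _ hZ]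
        _ ≤ ENNReal.ofReal h * C := mul_le_mul' le_rfl hZC
    have h4C0 : 4 * C ≠ 0 := mul_ne_zero (by norm_num) hC0
    have h4Ctop : 4 * C ≠ ⊤ := ENNReal.mul_ne_top (by norm_num) hC
    calc volume E = (4 * C)⁻¹ * (4 * C * volume E) := by
          rw [← mul_assoc, ENNReal.inv_mul_cancel h4C0 h4Ctop, one_mul]
      _ ≤ (4 * C)⁻¹ * (ENNReal.ofReal h * C) := mul_le_mul' le_rfl h1
      _ = ENNReal.ofReal h / 4 := by
          rw [mul_comm (ENNReal.ofReal h) C, ← mul_assoc, ENNReal.mul_inv (Or.inl (by norm_num))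
            (Or.inl (by norm_num)), mul_assoc (4 : ℝ≥0∞)⁻¹, ENNReal.inv_mul_cancel hC0 hC, mul_one,
            div_eq_mul_inv, mul_comm]
  have hv₁ := hquarter hX hA0 hA hXA hE₁m inter_subset_left (fun t ht => ht.2)
  have hv₂ := hquarter hY hB0 hB hYB hE₂m inter_subset_left (fun t ht => ht.2)
  -- but `[0,h] ⊆ E₁ ∪ E₂`
  have hcover : Icc (0 : ℝ) h ⊆ E₁ ∪ E₂ := by
    intro t ht
    by_cases h1 : 4 * A < ENNReal.ofReal h * X t
    · exact Or.inl ⟨ht, h1⟩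
    · exact Or.inr ⟨ht, hcon' t ht (not_lt.1 h1)⟩
  have hIcc : volume (Icc (0 : ℝ) h) = ENNReal.ofReal h := by rw [Real.volume_Icc, sub_zero]
  have hle : ENNReal.ofReal h ≤ ENNReal.ofReal h / 4 + ENNReal.ofReal h / 4 := by
    calc ENNReal.ofReal h = volume (Icc (0 : ℝ) h) := hIcc.symm
      _ ≤ volume (E₁ ∪ E₂) := measure_mono hcover
      _ ≤ volume E₁ + volume E₂ := measure_union_le _ _
      _ ≤ _ := add_le_add hv₁ hv₂
  -- `h ≤ h/2` contradicts `h > 0`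
  have hq : ENNReal.ofReal h / 4 ≠ ⊤ := ENNReal.div_ne_top ENNReal.ofReal_ne_top (by norm_num)
  have hr := ENNReal.toReal_mono (ENNReal.add_ne_top.2 ⟨hq, hq⟩) hle
  rw [ENNReal.toReal_add hq hq, ENNReal.toReal_div, ENNReal.toReal_ofReal hh.le] at hr
  norm_num at hr
  linarith

end Chebyshev



end NeedleThinCore

end Summit.NavierStokesRegularity.NavierStokesRegularity.Theorems.PowerGaugeEulerLiouville

end
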